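import Literature.LinearAlgebra.Subspace.SpanPairCount
import HarnessLib

/-!
# Second-moment counting over pairs of independent vectors; the three-set cover bound

Topic `LinearAlgebra/Subspace`, continuation of `SpanPairCount.lean` (same conventions: no
definition, finsets characterised by membership hypotheses).  For a set `E` of non-zero vectors of
a finite vector space `V` over a field with `q` elements and the family of ordered pairs `(v, w)` of
independent vectors:

* `card_mul_le_sum_card` / `sum_card_sq_le` — first and second moment of `|E ∩ span{v, w}|`;
* `card_mul_sq_le_of_sum_sq_le` — Chebyshev's inequality for a natural-valued statistic;
* `chebyshev_of_card_mul_ge` — the resulting bound on the number of planes poor in `E` when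
  `|E| (q + 1) ≥ 7 (|V| - 1)`;
* `card_mul_lt_of_cover` — **the cover bound**: if `E₁, E₂, E₃ ⊆ V ∖ {0}` are such that every
  plane `span{v, w}` has `≤ q - 1` vectors of `E₁`, or `≤ q - 1` of `E₂`, or `≤ 3(q - 1)` of `E₃`,
  then `|Eᵢ| (q + 1) < 7 (|V| - 1)` for some `i` (projectively: three point sets such that every
  line is poor in one of them cannot all have density `≥ 7/(q+1)`; `7/36 + 7/36 + 7/16 < 1`).

Standard "lines are pairwise balanced" second-moment count of finite geometry; consumer: the
matrix-multiplication summit (route `AlgebraicSTPPDichotomy`, STPP families of punctured lines over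
`F_q`) via `Literature/Computability/AlgebraicComplexity/STPPLineFamilies.lean`.  No fact, no def.
-/

open Submodule Finset

namespace Literature.LinearAlgebra.Subspace

section Chebyshev

/-- Chebyshev's inequality for a natural-valued statistic `X` on a finite set `D`, in the form used
for second-moment counting: if `Σ X² ≤ q₁ Σ X + nK`, `|D|·nK ≤ (Σ X)²` and `c|D| ≤ Σ X`, then the
number of `p` with `X p ≤ c` is at most `|D|² q₁ (Σ X) / (Σ X − c|D|)²`. [folklore] -/
theorem card_mul_sq_le_of_sum_sq_le {ι : Type*} (D B : Finset ι) (hB : B ⊆ D) (X : ι → ℕ)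
    (c : ℕ) (hBc : ∀ p ∈ B, X p ≤ c) (q₁ nK : ℝ)
    (hS : (∑ p ∈ D, ((X p : ℕ) : ℝ) ^ 2) ≤ q₁ * (∑ p ∈ D, ((X p : ℕ) : ℝ)) + nK)
    (hK : (D.card : ℝ) * nK ≤ (∑ p ∈ D, ((X p : ℕ) : ℝ)) ^ 2)
    (hc : (c : ℝ) * D.card ≤ ∑ p ∈ D, ((X p : ℕ) : ℝ)) :
    (B.card : ℝ) * ((∑ p ∈ D, ((X p : ℕ) : ℝ)) - c * D.card) ^ 2 ≤
      (D.card : ℝ) ^ 2 * q₁ * (∑ p ∈ D, ((X p : ℕ) : ℝ)) := by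
  set A : ℝ := ∑ p ∈ D, ((X p : ℕ) : ℝ) with hA
  set d : ℝ := (D.card : ℝ) with hd
  have hexp : ∑ p ∈ D, (d * X p - A) ^ 2 = d ^ 2 * (∑ p ∈ D, ((X p : ℕ) : ℝ) ^ 2) - d * A ^ 2 := by
    have : ∀ p ∈ D, (d * X p - A) ^ 2 = d ^ 2 * ((X p : ℕ) : ℝ) ^ 2 - 2 * d * A * X p + A ^ 2 := by
      intro p _; ring
    rw [sum_congr rfl this, sum_add_distrib, sum_sub_distrib, ← mul_sum, ← mul_sum, sum_const,
      nsmul_eq_mul, ← hA, ← hd]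
    ring
  have hup : ∑ p ∈ D, (d * X p - A) ^ 2 ≤ d ^ 2 * q₁ * A := by
    rw [hexp]
    have hd0 : 0 ≤ d := by rw [hd]; positivity
    nlinarith [mul_le_mul_of_nonneg_left hS (sq_nonneg d), hK]
  have hlow : (B.card : ℝ) * (A - c * d) ^ 2 ≤ ∑ p ∈ D, (d * X p - A) ^ 2 := by
    calc (B.card : ℝ) * (A - c * d) ^ 2 = ∑ p ∈ B, (A - c * d) ^ 2 := by
          rw [sum_const, nsmul_eq_mul]
      _ ≤ ∑ p ∈ B, (d * X p - A) ^ 2 := by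
          apply sum_le_sum
          intro p hp
          have h1 : d * X p ≤ c * d := by
            rw [mul_comm]
            have : ((X p : ℕ) : ℝ) ≤ c := by exact_mod_cast hBc p hp
            have hd0 : 0 ≤ d := by rw [hd]; positivity
            exact mul_le_mul_of_nonneg_right this hd0
          have h2 : 0 ≤ A - c * d := by linarith
          have h3 : A - c * d ≤ A - d * X p := by linarith
          calc (A - c * d) ^ 2 ≤ (A - d * X p) ^ 2 := pow_le_pow_left₀ h2 h3 2
            _ = (d * X p - A) ^ 2 := by ring
      _ ≤ ∑ p ∈ D, (d * X p - A) ^ 2 :=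
          sum_le_sum_of_subset_of_nonneg hB (fun p _ _ => sq_nonneg _)
  exact hlow.trans hup

/-- The numerical heart of the three-set cover argument: three "Chebyshev" bounds with means at
least `7b` cannot cover a set of positive size `d` (`7/36 + 7/36 + 7/16 < 1`). [folklore] -/
theorem false_of_three_chebyshev {d b a₁ a₂ a₃ B₁ B₂ B₃ : ℝ} (hd : 0 < d) (hb : 0 < b)
    (h₁ : 7 * b ≤ a₁) (h₂ : 7 * b ≤ a₂) (h₃ : 7 * b ≤ a₃)
    (hB₁ : 0 ≤ B₁) (hB₂ : 0 ≤ B₂) (hB₃ : 0 ≤ B₃)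
    (c₁ : B₁ * (a₁ - b) ^ 2 ≤ d * b * a₁) (c₂ : B₂ * (a₂ - b) ^ 2 ≤ d * b * a₂)
    (c₃ : B₃ * (a₃ - 3 * b) ^ 2 ≤ d * b * a₃) (hcov : d ≤ B₁ + B₂ + B₃) : False := by
  have k₁ : 36 / 7 * (a₁ * b) ≤ (a₁ - b) ^ 2 := by nlinarith
  have k₂ : 36 / 7 * (a₂ * b) ≤ (a₂ - b) ^ 2 := by nlinarith
  have k₃ : 16 / 7 * (a₃ * b) ≤ (a₃ - 3 * b) ^ 2 := by nlinarith
  have p₁ : 0 < a₁ * b := by nlinarith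
  have p₂ : 0 < a₂ * b := by nlinarith
  have p₃ : 0 < a₃ * b := by nlinarith
  have e₁ : B₁ * (36 / 7 * (a₁ * b)) ≤ d * (a₁ * b) := by
    calc B₁ * (36 / 7 * (a₁ * b)) ≤ B₁ * (a₁ - b) ^ 2 := mul_le_mul_of_nonneg_left k₁ hB₁
      _ ≤ d * b * a₁ := c₁
      _ = d * (a₁ * b) := by ring
  have e₂ : B₂ * (36 / 7 * (a₂ * b)) ≤ d * (a₂ * b) := by
    calc B₂ * (36 / 7 * (a₂ * b)) ≤ B₂ * (a₂ - b) ^ 2 := mul_le_mul_of_nonneg_left k₂ hB₂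
      _ ≤ d * b * a₂ := c₂
      _ = d * (a₂ * b) := by ring
  have e₃ : B₃ * (16 / 7 * (a₃ * b)) ≤ d * (a₃ * b) := by
    calc B₃ * (16 / 7 * (a₃ * b)) ≤ B₃ * (a₃ - 3 * b) ^ 2 := mul_le_mul_of_nonneg_left k₃ hB₃
      _ ≤ d * b * a₃ := c₃
      _ = d * (a₃ * b) := by ring
  have f₁ : B₁ * (36 / 7) ≤ d := le_of_mul_le_mul_right (by nlinarith [e₁]) p₁
  have f₂ : B₂ * (36 / 7) ≤ d := le_of_mul_le_mul_right (by nlinarith [e₂]) p₂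
  have f₃ : B₃ * (16 / 7) ≤ d := le_of_mul_le_mul_right (by nlinarith [e₃]) p₃
  nlinarith

end Chebyshev

section Moments
variable {F V : Type*} [Field F] [Fintype F] [AddCommGroup V] [Module F V] [DecidableEq V]
  [Fintype V]

/-- First moment: summing `|E ∩ span{v,w}|` over the ordered pairs of independent vectors counts
each `z ∈ E` (non-zero) at least `(|V| - q)(q² - 1)` times. [folklore] -/
theorem card_mul_le_sum_card (E : Finset V) (hE : (0 : V) ∉ E) (D : Finset (V × V))
    (hD : ∀ p, p ∈ D ↔ p.1 ≠ 0 ∧ p.2 ∉ span F ({p.1} : Set V)) (X : V × V → Finset V)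
    (hX : ∀ p z, z ∈ X p ↔ z ∈ E ∧ z ∈ span F ({p.1, p.2} : Set V)) :
    E.card * ((Fintype.card V - Fintype.card F) * (Fintype.card F ^ 2 - 1)) ≤
      ∑ p ∈ D, (X p).card := by
  classical
  have hXf : ∀ p, X p = E.filter (fun z => z ∈ span F ({p.1, p.2} : Set V)) := by
    intro p; ext z; simp [hX]
  calc E.card * ((Fintype.card V - Fintype.card F) * (Fintype.card F ^ 2 - 1))
      = ∑ z ∈ E, (Fintype.card V - Fintype.card F) * (Fintype.card F ^ 2 - 1) := by
        rw [sum_const, smul_eq_mul]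
    _ ≤ ∑ z ∈ E, (D.filter (fun p => z ∈ span F ({p.1, p.2} : Set V))).card := by
        apply sum_le_sum
        intro z hz
        have hz0 : z ≠ 0 := fun h => hE (h ▸ hz)
        exact le_card_pairs_mem_span (F := F) hz0 D hD _ (fun p => by simp)
    _ = ∑ z ∈ E, ∑ p ∈ D, (if z ∈ span F ({p.1, p.2} : Set V) then 1 else 0) := by
        simp_rw [card_filter]
    _ = ∑ p ∈ D, ∑ z ∈ E, (if z ∈ span F ({p.1, p.2} : Set V) then 1 else 0) := sum_comm
    _ = ∑ p ∈ D, (X p).card := by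
        simp_rw [hXf, card_filter]

/-- Second moment: `Σ |E ∩ span{v,w}|² ≤ (q - 1) Σ |E ∩ span{v,w}| + |E|² (q² - 1)(q² - q)` over
the ordered pairs of independent vectors, for a set `E` of non-zero vectors (pairs of dependent
elements of `E` are at most `q - 1` per element; two independent ones lie in at most
`(q² - 1)(q² - q)` of the planes). [folklore] -/
theorem sum_card_sq_le (E : Finset V) (hE : (0 : V) ∉ E) (D : Finset (V × V))
    (hD : ∀ p, p ∈ D ↔ p.1 ≠ 0 ∧ p.2 ∉ span F ({p.1} : Set V)) (X : V × V → Finset V)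
    (hX : ∀ p z, z ∈ X p ↔ z ∈ E ∧ z ∈ span F ({p.1, p.2} : Set V)) :
    ∑ p ∈ D, (X p).card ^ 2 ≤ (Fintype.card F - 1) * ∑ p ∈ D, (X p).card +
      E.card ^ 2 * ((Fintype.card F ^ 2 - 1) * (Fintype.card F ^ 2 - Fintype.card F)) := by
  classical
  have hXf : ∀ p, X p = E.filter (fun z => z ∈ span F ({p.1, p.2} : Set V)) := by
    intro p; ext z; simp [hX]
  set K := (Fintype.card F ^ 2 - 1) * (Fintype.card F ^ 2 - Fintype.card F) with hK
  -- fibres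
  set fz : V → ℕ := fun z => (D.filter (fun p => z ∈ span F ({p.1, p.2} : Set V))).card
    with hfz
  set pf : V → V → ℕ := fun z z' => (D.filter (fun p => z ∈ span F ({p.1, p.2} : Set V) ∧
    z' ∈ span F ({p.1, p.2} : Set V))).card with hpf
  have hswap : ∑ p ∈ D, (X p).card = ∑ z ∈ E, fz z := by
    simp_rw [hXf, hfz, card_filter]
    exact sum_comm
  have hsq : ∑ p ∈ D, (X p).card ^ 2 = ∑ z ∈ E, ∑ z' ∈ E, pf z z' := by
    have h1 : ∀ p ∈ D, (X p).card ^ 2 = ∑ z ∈ E, ∑ z' ∈ E,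
        (if z ∈ span F ({p.1, p.2} : Set V) ∧ z' ∈ span F ({p.1, p.2} : Set V)
          then 1 else 0) := by
      intro p _
      rw [hXf, card_filter, sq, sum_mul_sum]
      refine sum_congr rfl fun z _ => sum_congr rfl fun z' _ => ?_
      split_ifs <;> simp_all
    rw [sum_congr rfl h1, sum_comm]
    refine sum_congr rfl fun z _ => ?_
    rw [sum_comm]
    refine sum_congr rfl fun z' _ => ?_
    simp only [hpf, card_filter]
  have hbound : ∀ z ∈ E, ∑ z' ∈ E, pf z z' ≤ (Fintype.card F - 1) * fz z + E.card * K := by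
    intro z hz
    have hz0 : z ≠ 0 := fun h => hE (h ▸ hz)
    rw [← sum_filter_add_sum_filter_not E (fun z' => z' ∈ span F ({z} : Set V))]
    apply add_le_add
    · -- dependent `z'`: at most `q - 1` of them, each fibre ≤ fz z
      have hle : ∀ z' ∈ E.filter (fun z' => z' ∈ span F ({z} : Set V)), pf z z' ≤ fz z := by
        intro z' _
        apply card_le_card
        intro p hp
        simp only [mem_filter] at hp ⊢
        exact ⟨hp.1, hp.2.1⟩
      refine (sum_le_sum hle).trans ?_
      rw [sum_const, smul_eq_mul]
      apply Nat.mul_le_mul_right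
      have hsub : E.filter (fun z' => z' ∈ span F ({z} : Set V)) ⊆
          (univ.filter (fun z' : V => z' ∈ span F ({z} : Set V))).erase 0 := by
        intro z' hz'
        simp only [mem_filter, mem_erase, mem_univ, true_and] at hz' ⊢
        exact ⟨fun h => hE (h ▸ hz'.1), hz'.2⟩
      refine (card_le_card hsub).trans ?_
      rw [card_erase_of_mem (by simp), card_eq_of_mem_iff_mem_span_singleton (F := F) hz0 _
        (fun x => by simp)]
    · -- independent `z'`: each fibre ≤ K
      have hle : ∀ z' ∈ E.filter (fun z' => z' ∉ span F ({z} : Set V)), pf z z' ≤ K := by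
        intro z' hz'
        simp only [mem_filter] at hz'
        exact card_pairs_mem_span_le (F := F) hz0 hz'.2 D hD _ (fun p => by simp)
      refine (sum_le_sum hle).trans ?_
      rw [sum_const, smul_eq_mul]
      exact Nat.mul_le_mul_right _ (card_le_card (filter_subset _ _))
  calc ∑ p ∈ D, (X p).card ^ 2 = ∑ z ∈ E, ∑ z' ∈ E, pf z z' := hsq
    _ ≤ ∑ z ∈ E, ((Fintype.card F - 1) * fz z + E.card * K) := sum_le_sum hbound
    _ = (Fintype.card F - 1) * ∑ p ∈ D, (X p).card + E.card ^ 2 * K := by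
        rw [sum_add_distrib, ← mul_sum, sum_const, smul_eq_mul, hswap]; ring

end Moments

section Main
variable {F V : Type*} [Field F] [Fintype F] [AddCommGroup V] [Module F V] [DecidableEq V]
  [Fintype V]

/-- One colour class of the cover argument, in real form: if `|E|(q+1) ≥ 7(|V| - 1)` then the sum
`A = Σ_{(v,w)} |E ∩ span{v,w}|` over ordered pairs of independent vectors is at least `7b`,
`b = (q-1)|D|`, and the pairs whose plane meets `E` in at most `c₀(q-1)` vectors (`c₀ ≤ 7`) number
at most `|D| b A/(A - c₀ b)²`. [folklore] -/
theorem chebyshev_of_card_mul_ge (hV : Fintype.card F ^ 2 ≤ Fintype.card V) (E : Finset V)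
    (hE : (0 : V) ∉ E) (D : Finset (V × V))
    (hD : ∀ p, p ∈ D ↔ p.1 ≠ 0 ∧ p.2 ∉ span F ({p.1} : Set V)) (X : V × V → Finset V)
    (hX : ∀ p z, z ∈ X p ↔ z ∈ E ∧ z ∈ span F ({p.1, p.2} : Set V)) (c₀ : ℕ) (hc₀ : c₀ ≤ 7)
    (B : Finset (V × V)) (hB : ∀ p, p ∈ B ↔ p ∈ D ∧ (X p).card ≤ c₀ * (Fintype.card F - 1))
    (hn : 7 * Fintype.card V ≤ E.card * (Fintype.card F + 1) + 7) :
    7 * (((Fintype.card F : ℝ) - 1) * D.card) ≤ (∑ p ∈ D, ((X p).card : ℝ)) ∧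
      (B.card : ℝ) * ((∑ p ∈ D, ((X p).card : ℝ)) -
          c₀ * (((Fintype.card F : ℝ) - 1) * D.card)) ^ 2 ≤
        (D.card : ℝ) * (((Fintype.card F : ℝ) - 1) * D.card) * (∑ p ∈ D, ((X p).card : ℝ)) := by
  have h1q : 1 < Fintype.card F := Fintype.one_lt_card
  have hqq : Fintype.card F ≤ Fintype.card F ^ 2 := by nlinarith
  have hqQ : Fintype.card F ≤ Fintype.card V := hqq.trans hV
  have h1Q : 1 ≤ Fintype.card V := le_trans h1q.le hqQ
  have h1q2 : 1 ≤ Fintype.card F ^ 2 := le_trans h1q.le hqq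
  obtain ⟨q, hq⟩ : ∃ q : ℝ, q = Fintype.card F := ⟨_, rfl⟩
  obtain ⟨Q, hQ⟩ : ∃ Q : ℝ, Q = Fintype.card V := ⟨_, rfl⟩
  have hqr : (1 : ℝ) < q := by rw [hq]; exact_mod_cast h1q
  have hVr : q ^ 2 ≤ Q := by rw [hq, hQ]; exact_mod_cast hV
  have hqQr : q ≤ Q := by rw [hq, hQ]; exact_mod_cast hqQ
  have hd : (D.card : ℝ) = (Q - 1) * (Q - q) := by
    rw [card_pairs_eq (F := F) D hD, Nat.cast_mul, Nat.cast_sub h1Q, Nat.cast_sub hqQ,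
      Nat.cast_one, hq, hQ]
  set A : ℝ := ∑ p ∈ D, ((X p).card : ℝ) with hA
  have hfirst : (E.card : ℝ) * ((Q - q) * (q ^ 2 - 1)) ≤ A := by
    have := (Nat.cast_le (α := ℝ)).2 (card_mul_le_sum_card (F := F) E hE D hD X hX)
    rw [Nat.cast_mul, Nat.cast_mul, Nat.cast_sub hqQ, Nat.cast_sub h1q2, Nat.cast_pow,
      Nat.cast_one, Nat.cast_sum, ← hq, ← hQ] at this
    exact this
  have hsecond : (∑ p ∈ D, ((X p).card : ℝ) ^ 2) ≤ (q - 1) * A +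
      (E.card : ℝ) ^ 2 * ((q ^ 2 - 1) * (q ^ 2 - q)) := by
    have := (Nat.cast_le (α := ℝ)).2 (sum_card_sq_le (F := F) E hE D hD X hX)
    rw [Nat.cast_add, Nat.cast_mul, Nat.cast_mul, Nat.cast_mul, Nat.cast_sub h1q.le,
      Nat.cast_sub h1q2, Nat.cast_sub hqq, Nat.cast_pow, Nat.cast_pow, Nat.cast_one,
      Nat.cast_sum, Nat.cast_sum, ← hq] at this
    simpa only [Nat.cast_pow] using this
  have hn' : 7 * (Q - 1) ≤ (E.card : ℝ) * (q + 1) := by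
    have := (Nat.cast_le (α := ℝ)).2 hn
    push_cast at this
    rw [hq, hQ]
    linarith
  have hQq : (0 : ℝ) ≤ Q - q := by linarith
  have hq1 : (0 : ℝ) ≤ q - 1 := by linarith
  have hq21 : (0 : ℝ) ≤ q ^ 2 - 1 := by nlinarith
  have hb : 7 * ((q - 1) * D.card) ≤ A := by
    rw [hd]
    calc 7 * ((q - 1) * ((Q - 1) * (Q - q)))
        = (7 * (Q - 1)) * ((q - 1) * (Q - q)) := by ring
      _ ≤ ((E.card : ℝ) * (q + 1)) * ((q - 1) * (Q - q)) :=
          mul_le_mul_of_nonneg_right hn' (mul_nonneg hq1 hQq)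
      _ = (E.card : ℝ) * ((Q - q) * (q ^ 2 - 1)) := by ring
      _ ≤ A := hfirst
  have hbq : 7 * (((Fintype.card F : ℝ) - 1) * D.card) ≤ A := by rw [← hq]; exact hb
  refine ⟨hbq, ?_⟩
  have hBD : B ⊆ D := fun p hp => ((hB p).1 hp).1
  have hBc : ∀ p ∈ B, (X p).card ≤ c₀ * (Fintype.card F - 1) := fun p hp => ((hB p).1 hp).2
  have hK : (D.card : ℝ) * ((E.card : ℝ) ^ 2 * ((q ^ 2 - 1) * (q ^ 2 - q))) ≤ A ^ 2 := by
    have hR0 : (0 : ℝ) ≤ (E.card : ℝ) * ((Q - q) * (q ^ 2 - 1)) :=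
      mul_nonneg (Nat.cast_nonneg _) (mul_nonneg hQq hq21)
    have hsq : ((E.card : ℝ) * ((Q - q) * (q ^ 2 - 1))) ^ 2 ≤ A ^ 2 :=
      pow_le_pow_left₀ hR0 hfirst 2
    have hid : (Q - 1) * (q ^ 2 - q) ≤ (Q - q) * (q ^ 2 - 1) := by nlinarith
    have hDK : (D.card : ℝ) * ((q ^ 2 - 1) * (q ^ 2 - q)) ≤ ((Q - q) * (q ^ 2 - 1)) ^ 2 := by
      rw [hd]
      calc (Q - 1) * (Q - q) * ((q ^ 2 - 1) * (q ^ 2 - q))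
          = ((Q - 1) * (q ^ 2 - q)) * ((Q - q) * (q ^ 2 - 1)) := by ring
        _ ≤ ((Q - q) * (q ^ 2 - 1)) * ((Q - q) * (q ^ 2 - 1)) :=
            mul_le_mul_of_nonneg_right hid (mul_nonneg hQq hq21)
        _ = ((Q - q) * (q ^ 2 - 1)) ^ 2 := by ring
    calc (D.card : ℝ) * ((E.card : ℝ) ^ 2 * ((q ^ 2 - 1) * (q ^ 2 - q)))
        = (E.card : ℝ) ^ 2 * ((D.card : ℝ) * ((q ^ 2 - 1) * (q ^ 2 - q))) := by ring
      _ ≤ (E.card : ℝ) ^ 2 * ((Q - q) * (q ^ 2 - 1)) ^ 2 :=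
          mul_le_mul_of_nonneg_left hDK (sq_nonneg _)
      _ = ((E.card : ℝ) * ((Q - q) * (q ^ 2 - 1))) ^ 2 := by ring
      _ ≤ A ^ 2 := hsq
  have hc : ((c₀ * (Fintype.card F - 1) : ℕ) : ℝ) * D.card ≤ ∑ p ∈ D, (((X p).card : ℕ) : ℝ) := by
    rw [← hA, Nat.cast_mul, Nat.cast_sub h1q.le, Nat.cast_one, ← hq]
    have hc7 : (c₀ : ℝ) ≤ 7 := by exact_mod_cast hc₀
    have hbd : (0 : ℝ) ≤ (q - 1) * D.card := mul_nonneg hq1 (Nat.cast_nonneg _)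
    calc (c₀ : ℝ) * (q - 1) * D.card = c₀ * ((q - 1) * D.card) := by ring
      _ ≤ 7 * ((q - 1) * D.card) := mul_le_mul_of_nonneg_right hc7 hbd
      _ ≤ A := hb
  have hcheb := card_mul_sq_le_of_sum_sq_le D B hBD (fun p => (X p).card)
    (c₀ * (Fintype.card F - 1)) hBc (q - 1) ((E.card : ℝ) ^ 2 * ((q ^ 2 - 1) * (q ^ 2 - q)))
    (by rw [← hA]; exact hsecond) (by rw [← hA]; exact hK) hc
  rw [← hA, Nat.cast_mul, Nat.cast_sub h1q.le, Nat.cast_one, ← hq] at hcheb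
  rw [← hq]
  convert hcheb using 2 <;> ring

/-- **Three sets of non-zero vectors such that every plane through the origin is poor in one of
them cannot all be dense.**  Let `V` be a finite vector space over a field with `q` elements,
`|V| ≥ q²`, and `E₁, E₂, E₃ ⊆ V ∖ {0}`.  If for every pair of independent vectors `v, w` the plane
`span{v, w}` satisfies `|E₁ ∩ span{v,w}| ≤ q - 1` or `|E₂ ∩ span{v,w}| ≤ q - 1` or
`|E₃ ∩ span{v,w}| ≤ 3(q - 1)`, then `|Eᵢ| (q + 1) < 7 (|V| - 1)` for some `i`.  (Projectively: if
every line has at most `1`, `1`, resp. `3` points in one of three point sets, one of the sets has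
density `< 7/(q+1)`; second-moment count over lines, `7/36 + 7/36 + 7/16 < 1`.) [folklore] -/
theorem card_mul_lt_of_cover (E₁ E₂ E₃ : Finset V) (h₁ : (0 : V) ∉ E₁) (h₂ : (0 : V) ∉ E₂)
    (h₃ : (0 : V) ∉ E₃) (hV : Fintype.card F ^ 2 ≤ Fintype.card V)
    (hcover : ∀ (v w : V) (L : Finset V), v ≠ 0 → w ∉ span F ({v} : Set V) →
      (∀ x, x ∈ L ↔ x ∈ span F ({v, w} : Set V)) →
      (E₁ ∩ L).card + 1 ≤ Fintype.card F ∨ (E₂ ∩ L).card + 1 ≤ Fintype.card F ∨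
        (E₃ ∩ L).card + 3 ≤ 3 * Fintype.card F) :
    E₁.card * (Fintype.card F + 1) + 7 < 7 * Fintype.card V ∨
      E₂.card * (Fintype.card F + 1) + 7 < 7 * Fintype.card V ∨
      E₃.card * (Fintype.card F + 1) + 7 < 7 * Fintype.card V := by
  classical
  by_contra hcon
  push Not at hcon
  obtain ⟨hn₁, hn₂, hn₃⟩ := hcon
  have h1q : 1 < Fintype.card F := Fintype.one_lt_card
  have hqq : Fintype.card F ≤ Fintype.card F ^ 2 := by nlinarith
  have hqQ : Fintype.card F ≤ Fintype.card V := hqq.trans hV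
  have h1Q : 1 ≤ Fintype.card V := le_trans h1q.le hqQ
  set D : Finset (V × V) :=
    univ.filter (fun p : V × V => p.1 ≠ 0 ∧ p.2 ∉ span F ({p.1} : Set V)) with hDdef
  have hD : ∀ p, p ∈ D ↔ p.1 ≠ 0 ∧ p.2 ∉ span F ({p.1} : Set V) := fun p => by
    simp [hDdef]
  set X₁ : V × V → Finset V := fun p => E₁.filter (fun z => z ∈ span F ({p.1, p.2} : Set V))
    with hX₁
  set X₂ : V × V → Finset V := fun p => E₂.filter (fun z => z ∈ span F ({p.1, p.2} : Set V))
    with hX₂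
  set X₃ : V × V → Finset V := fun p => E₃.filter (fun z => z ∈ span F ({p.1, p.2} : Set V))
    with hX₃
  set B₁ : Finset (V × V) := D.filter (fun p => (X₁ p).card ≤ 1 * (Fintype.card F - 1))
    with hB₁
  set B₂ : Finset (V × V) := D.filter (fun p => (X₂ p).card ≤ 1 * (Fintype.card F - 1))
    with hB₂
  set B₃ : Finset (V × V) := D.filter (fun p => (X₃ p).card ≤ 3 * (Fintype.card F - 1))
    with hB₃
  obtain ⟨hb₁, c₁⟩ := chebyshev_of_card_mul_ge (F := F) hV E₁ h₁ D hD X₁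
    (fun p z => by simp [hX₁]) 1 (by norm_num) B₁ (fun p => by rw [hB₁, mem_filter]) hn₁
  obtain ⟨hb₂, c₂⟩ := chebyshev_of_card_mul_ge (F := F) hV E₂ h₂ D hD X₂
    (fun p z => by simp [hX₂]) 1 (by norm_num) B₂ (fun p => by rw [hB₂, mem_filter]) hn₂
  obtain ⟨hb₃, c₃⟩ := chebyshev_of_card_mul_ge (F := F) hV E₃ h₃ D hD X₃
    (fun p z => by simp [hX₃]) 3 (by norm_num) B₃ (fun p => by rw [hB₃, mem_filter]) hn₃
  have hcov : D ⊆ B₁ ∪ B₂ ∪ B₃ := by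
    intro p hp
    obtain ⟨hv, hw⟩ := (hD p).1 hp
    set L : Finset V := univ.filter (fun x : V => x ∈ span F ({p.1, p.2} : Set V)) with hL
    have hEL : ∀ E : Finset V, E ∩ L = E.filter (fun z => z ∈ span F ({p.1, p.2} : Set V)) := by
      intro E; ext z; simp [hL]
    rcases hcover p.1 p.2 L hv hw (fun x => by simp [hL]) with h | h | h
    · refine mem_union_left _ (mem_union_left _ ?_)
      rw [hB₁, mem_filter]
      refine ⟨hp, ?_⟩
      rw [hEL] at h
      simp only [hX₁]
      omega
    · refine mem_union_left _ (mem_union_right _ ?_)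
      rw [hB₂, mem_filter]
      refine ⟨hp, ?_⟩
      rw [hEL] at h
      simp only [hX₂]
      omega
    · refine mem_union_right _ ?_
      rw [hB₃, mem_filter]
      refine ⟨hp, ?_⟩
      rw [hEL] at h
      simp only [hX₃]
      omega
  have hcovR : (D.card : ℝ) ≤ B₁.card + B₂.card + B₃.card := by
    have := (card_le_card hcov).trans ((card_union_le _ _).trans
      (Nat.add_le_add_right (card_union_le _ _) _))
    exact_mod_cast this
  have hqr : (1 : ℝ) < Fintype.card F := by exact_mod_cast h1q
  have hVr : (Fintype.card F : ℝ) ^ 2 ≤ Fintype.card V := by exact_mod_cast hV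
  have hqQr : (Fintype.card F : ℝ) ≤ Fintype.card V := by exact_mod_cast hqQ
  have hd : (D.card : ℝ) = ((Fintype.card V : ℝ) - 1) * ((Fintype.card V : ℝ) - Fintype.card F) := by
    rw [card_pairs_eq (F := F) D hD, Nat.cast_mul, Nat.cast_sub h1Q, Nat.cast_sub hqQ,
      Nat.cast_one]
  have hdpos : (0 : ℝ) < D.card := by
    rw [hd]; apply mul_pos <;> nlinarith
  have hbpos : (0 : ℝ) < ((Fintype.card F : ℝ) - 1) * D.card := mul_pos (by linarith) hdpos
  refine false_of_three_chebyshev hdpos hbpos hb₁ hb₂ hb₃ (Nat.cast_nonneg _)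
    (Nat.cast_nonneg _) (Nat.cast_nonneg _) ?_ ?_ ?_ hcovR
  · convert c₁ using 2; push_cast; ring
  · convert c₂ using 2; push_cast; ring
  · convert c₃ using 2; push_cast; ring

end Main
end Literature.LinearAlgebra.Subspace
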